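import Mathlib.CategoryTheory.Limits.FullSubcategory
import Mathlib.CategoryTheory.Countable
import Literature.AnabelianGeometry.SemiGraphs.BTempLimitsProofs
import Literature.AnabelianGeometry.SemiGraphs.NotationsConventions
import HarnessLib

/-!
# Semi-graphs of anabelioids, §0 / Appendix: `C[A] ⊆ C` is DOWNWARD CLOSED, so the inclusion preserves
# every colimit that `C` has (and the limits of shapes with an object)

Mochizuki, *Semi-graphs of anabelioids*, Publ. RIMS **42** (2006) 221–322, §0 p. 6
[cite: MochizukiSemiAnbd2006, §0 p.6]: "`C[A] ⊆ C`, the full subcategory determined by the objects of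
`C` that admit a morphism to `A`"; Appendix, Definition A.1 (i) p. 79: "`T[A]`" for a connected object
`A` of a connected temperoid `T` (a connected quasi-temperoid), and the proof of Theorem A.4, p. 85
(PRIMS p. 315) [cite: MochizukiSemiAnbd2006, Thm A.4 proof p.85]: "since `φ^*` preserves countable
colimits … The fact that the resulting functor `ψ^* : T₂ → T₁` preserves countable colimits
(respectively, fibered products) follows by a routine argument from the fact that `φ^*` preserves
countable colimits (respectively, countable colimits and finite limits)."

This file records the elementary category theory behind that "routine argument" (row **A4-∃**, the
coequaliser route to the existence half of Thm. A.4, of the abc-iut cell's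
`plan/L3/SUBDAG-SemiAnbd-Cor311.md`; file E1 of the engine, seat abc-iut-w5-d220 for abc-iut-w4-d110):

* `admitsHomTo_of_hom` — `C[A]` is DOWNWARD CLOSED: an object mapping to an object of `C[A]` lies in
  `C[A]`;
* hence **the inclusion `ι : C[A] ⥤ C` PRESERVES EVERY COLIMIT THAT EXISTS IN `C`**
  (`preservesColimit_ι`, `preservesColimitsOfShape_ι`): the colimit in `C` of a diagram of `C[A]`
  MAPS TO the vertex of any cocone of `C[A]`, which maps to `A`, so it lies in `C[A]` and is the
  colimit there (Mathlib's `createsColimitFullSubcategoryInclusion'`); and a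
  diagram of `C[A]` with a colimit in `C` and a cocone in `C[A]` has a colimit in `C[A]`
  (`hasColimit_of_cocone`); cocones of `C[A]` are colimits iff they are in `C` (`isColimit_map_iff`);
* `ι` reflects limits and colimits (fully faithful) and preserves the limits of every shape WITH AN
  OBJECT that `C` has (`C[A]` is closed under such limits: the limit maps to `A` through a leg);
* for the model temperoid `T = B^temp(Π)` (`Π` any topological group): `ι : T[A] ⥤ B^temp(Π)` preserves
  colimits of every COUNTABLE shape and (composed with the fibre functor) these colimits are computed
  on underlying sets; it preserves finite limits of shapes with an object.

Pure category theory over the tree's typing of `C[A]` (`admitsHomTo`, `Over'`,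
`NotationsConventions.lean`) and of countable colimits in `B^temp(Π)` (`BTempLimitsProofs.lean`); no new
definitions; nothing refers to the IUT corpus and no side is taken on any disputed claim.
-/

open CategoryTheory CategoryTheory.Limits

namespace Literature.AnabelianGeometry.SemiGraphs

universe w w' v u

/-! ### `C[A]` is downward closed; the inclusion preserves the colimits of `C` -/

section General

variable {C : Type u} [Category.{v} C] (A : C)

/-- **`C[A]` is downward closed**: if `Y` admits a morphism to `A`, so does every `X` mapping to `Y`.
[cite: MochizukiSemiAnbd2006, §0 p.6] -/
theorem admitsHomTo_of_hom {X Y : C} (f : X ⟶ Y) (hY : admitsHomTo A Y) : admitsHomTo A X :=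
  ⟨f ≫ hY.some⟩

/-- The structure "arrow to `A`" of an object of `C[A]`, chosen. [cite: MochizukiSemiAnbd2006, §0 p.6] -/
theorem admitsHomTo_obj (X : Over' A) : admitsHomTo A X.obj := X.property

variable {J : Type w} [Category.{w'} J]

/-- The vertex of a colimit cocone IN `C` of a diagram of `C[A]` lies in `C[A]` as soon as the diagram
has SOME cocone in `C[A]` (the colimit maps to that cocone's vertex, which maps to `A`).
[cite: MochizukiSemiAnbd2006, §0 p.6] -/
theorem admitsHomTo_pt_of_isColimit (K : J ⥤ Over' A) {t : Cocone (K ⋙ (admitsHomTo A).ι)}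
    (ht : IsColimit t) (c : Cocone K) : admitsHomTo A t.pt :=
  ⟨ht.desc ((admitsHomTo A).ι.mapCocone c) ≫ c.pt.property.some⟩

/-- **The inclusion `C[A] ⥤ C` preserves the colimit of any diagram that has a colimit in `C`.**
[cite: MochizukiSemiAnbd2006, §0 p.6] -/
theorem preservesColimit_ι (K : J ⥤ Over' A) [HasColimit (K ⋙ (admitsHomTo A).ι)] :
    PreservesColimit K (admitsHomTo A).ι where
  preserves {c} hc := by
    letI : CreatesColimit K (admitsHomTo A).ι :=
      createsColimitFullSubcategoryInclusion' K (colimit.isColimit _)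
        (admitsHomTo_pt_of_isColimit A K (colimit.isColimit _) c)
    exact ⟨isColimitOfPreserves (admitsHomTo A).ι hc⟩

/-- **The inclusion `C[A] ⥤ C` preserves colimits of every shape that `C` has.**
[cite: MochizukiSemiAnbd2006, §0 p.6] -/
theorem preservesColimitsOfShape_ι [HasColimitsOfShape J C] :
    PreservesColimitsOfShape J (admitsHomTo A).ι where
  preservesColimit {K} := preservesColimit_ι A K

/-- A diagram of `C[A]` with a colimit in `C` and a cocone in `C[A]` has a colimit in `C[A]`.
[cite: MochizukiSemiAnbd2006, §0 p.6] -/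
theorem hasColimit_of_cocone (K : J ⥤ Over' A) [HasColimit (K ⋙ (admitsHomTo A).ι)]
    (c : Cocone K) : HasColimit K :=
  letI : CreatesColimit K (admitsHomTo A).ι :=
    createsColimitFullSubcategoryInclusion' K (colimit.isColimit _)
      (admitsHomTo_pt_of_isColimit A K (colimit.isColimit _) c)
  hasColimit_of_created K (admitsHomTo A).ι

/-- A cocone of `C[A]` (under a diagram with a colimit in `C`) is a colimit in `C[A]` iff it is a
colimit in `C`. [cite: MochizukiSemiAnbd2006, §0 p.6] -/
theorem isColimit_map_iff (K : J ⥤ Over' A) [HasColimit (K ⋙ (admitsHomTo A).ι)] (c : Cocone K) :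
    Nonempty (IsColimit ((admitsHomTo A).ι.mapCocone c)) ↔ Nonempty (IsColimit c) :=
  ⟨fun ⟨h⟩ => ⟨isColimitOfReflects (admitsHomTo A).ι h⟩,
   fun ⟨h⟩ => by
    haveI := preservesColimit_ι A K
    exact ⟨isColimitOfPreserves (admitsHomTo A).ι h⟩⟩

/-- The inclusion `C[A] ⥤ C` reflects colimits of every shape (it is fully faithful).
[cite: MochizukiSemiAnbd2006, §0 p.6] -/
theorem reflectsColimitsOfShape_ι : ReflectsColimitsOfShape J (admitsHomTo A).ι := inferInstance

/-- The inclusion `C[A] ⥤ C` reflects limits of every shape (it is fully faithful).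
[cite: MochizukiSemiAnbd2006, §0 p.6] -/
theorem reflectsLimitsOfShape_ι : ReflectsLimitsOfShape J (admitsHomTo A).ι := inferInstance

/-- `C[A]` is closed under limits of every shape with an object `j₀` (the limit maps to `A` through
its `j₀`-th leg) — universe-polymorphic form of `admitsHomTo_isClosedUnderLimitsOfShape`.
[cite: MochizukiSemiAnbd2006, §0 p.6] -/
theorem admitsHomTo_isClosedUnderLimitsOfShape_of_obj (j₀ : J) :
    (admitsHomTo A).IsClosedUnderLimitsOfShape J :=
  ⟨fun _ hX => by
    obtain ⟨p⟩ := hX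
    exact ⟨p.π.app j₀ ≫ (p.prop_diag_obj j₀).some⟩⟩

/-- **The inclusion `C[A] ⥤ C` preserves limits of every shape with an object that `C` has.**
[cite: MochizukiSemiAnbd2006, §0 p.6] -/
theorem preservesLimitsOfShape_ι (j₀ : J) [HasLimitsOfShape J C] :
    PreservesLimitsOfShape J (admitsHomTo A).ι := by
  haveI := admitsHomTo_isClosedUnderLimitsOfShape_of_obj A j₀
  infer_instance

/-- `C[A]` has the limits of every shape with an object that `C` has (computed in `C`).
[cite: MochizukiSemiAnbd2006, §0 p.6] -/
theorem hasLimitsOfShape_overPrime (j₀ : J) [HasLimitsOfShape J C] : HasLimitsOfShape J (Over' A) := by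
  haveI := admitsHomTo_isClosedUnderLimitsOfShape_of_obj A j₀
  infer_instance

/-- A cone of `C[A]` over a shape with an object (that has limits in `C`) is a limit in `C[A]` iff it
is a limit in `C`. [cite: MochizukiSemiAnbd2006, §0 p.6] -/
theorem isLimit_map_iff (j₀ : J) [HasLimitsOfShape J C] (K : J ⥤ Over' A) (c : Cone K) :
    Nonempty (IsLimit ((admitsHomTo A).ι.mapCone c)) ↔ Nonempty (IsLimit c) :=
  ⟨fun ⟨h⟩ => ⟨isLimitOfReflects (admitsHomTo A).ι h⟩,
   fun ⟨h⟩ => by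
    haveI := preservesLimitsOfShape_ι A j₀
    exact ⟨isLimitOfPreserves (admitsHomTo A).ι h⟩⟩

end General

/-! ### In `B^temp(Π)`: `T[A] ⥤ B^temp(Π)` preserves countable colimits and finite nonempty limits -/

section BTemp

variable {G : Type u} [Group G] [TopologicalSpace G] [IsTopologicalGroup G] (A : BTemp G)

/-- **`T[A] ⥤ B^temp(Π)` preserves colimits of every countable shape** (`B^temp(Π)` has them,
`BTemp.hasColimitsOfShape_of_countable`, and `T[A]` is downward closed).
[cite: MochizukiSemiAnbd2006, Thm A.4 proof p.85] -/
theorem overPrime_ι_preservesColimitsOfShape (J : Type) [SmallCategory J] [Countable J] :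
    PreservesColimitsOfShape J (admitsHomTo A).ι := by
  haveI := BTemp.hasColimitsOfShape_of_countable (G := G) J
  exact preservesColimitsOfShape_ι A

/-- The same for Mathlib's `CountableCategory` shapes (countably many objects and arrows).
[cite: MochizukiSemiAnbd2006, Thm A.4 proof p.85] -/
theorem overPrime_ι_preservesColimitsOfShape_of_countableCategory (J : Type) [SmallCategory J]
    [CountableCategory J] : PreservesColimitsOfShape J (admitsHomTo A).ι :=
  overPrime_ι_preservesColimitsOfShape A J

/-- Countable colimits of `T[A]` (of diagrams having one) are computed ON UNDERLYING SETS: the composite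
`T[A] ⥤ B^temp(Π) ⥤ Type` preserves them. [cite: MochizukiSemiAnbd2006, Thm A.4 proof p.85] -/
theorem overPrime_fibre_preservesColimitsOfShape (J : Type) [SmallCategory J] [Countable J] :
    PreservesColimitsOfShape J
      ((admitsHomTo A).ι ⋙ (temperedAction G).ι ⋙ Action.forget (Type u) G) := by
  haveI := overPrime_ι_preservesColimitsOfShape A J
  haveI := BTemp.preservesColimitsOfShape_forget (G := G) J
  infer_instance

/-- A diagram of `T[A]` of countable shape with a cocone in `T[A]` has a colimit in `T[A]` (the one of
`B^temp(Π)`). [cite: MochizukiSemiAnbd2006, Thm A.4 proof p.85] -/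
theorem overPrime_hasColimit_of_cocone {J : Type} [SmallCategory J] [Countable J] (K : J ⥤ Over' A)
    (c : Cocone K) : HasColimit K := by
  haveI := BTemp.hasColimitsOfShape_of_countable (G := G) J
  exact hasColimit_of_cocone A K c

/-- A cocone of `T[A]` under a diagram of countable shape is a colimit in `T[A]` iff it is a colimit in
`B^temp(Π)`. [cite: MochizukiSemiAnbd2006, Thm A.4 proof p.85] -/
theorem overPrime_isColimit_map_iff {J : Type} [SmallCategory J] [Countable J] (K : J ⥤ Over' A)
    (c : Cocone K) :
    Nonempty (IsColimit ((admitsHomTo A).ι.mapCocone c)) ↔ Nonempty (IsColimit c) := by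
  haveI := BTemp.hasColimitsOfShape_of_countable (G := G) J
  exact isColimit_map_iff A K c

/-- **`T[A] ⥤ B^temp(Π)` preserves limits of every finite shape with an object** (equalisers, fibre
products, finite nonempty products). [cite: MochizukiSemiAnbd2006, Thm A.4 proof p.85] -/
theorem overPrime_ι_preservesLimitsOfShape (J : Type) [SmallCategory J] [FinCategory J] (j₀ : J) :
    PreservesLimitsOfShape J (admitsHomTo A).ι := by
  haveI := BTemp.hasLimitsOfShape_of_finCategory (G := G) J
  exact preservesLimitsOfShape_ι A j₀

/-- A cone of `T[A]` over a finite shape with an object is a limit in `T[A]` iff it is one in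
`B^temp(Π)`. [cite: MochizukiSemiAnbd2006, Thm A.4 proof p.85] -/
theorem overPrime_isLimit_map_iff {J : Type} [SmallCategory J] [FinCategory J] (j₀ : J)
    (K : J ⥤ Over' A) (c : Cone K) :
    Nonempty (IsLimit ((admitsHomTo A).ι.mapCone c)) ↔ Nonempty (IsLimit c) := by
  haveI := BTemp.hasLimitsOfShape_of_finCategory (G := G) J
  exact isLimit_map_iff A j₀ K c

end BTemp

end Literature.AnabelianGeometry.SemiGraphs
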